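import Summits.Ventures.PercRepro.Orbit

/-!
# PercRepro — `markClasses` on three marks reads the events `T`, `Y`, `B` of COUNT-NAN3 (typer-2, gen 5)

Consistency of the two vocabularies: `N(ω) = markClasses ω ![a, b, c]` is `1` exactly on `T = allConn3`
(all three marks connected), `3` exactly on `B = allSep3` (pairwise separated), and `2` exactly on
`Y = onePair3` (exactly one pair connected). So the interval hypotheses of `Orbit2All` — `N(I) = 3`,
`N(I ⊔ D) = 1` — are `I ∈ B`, `I ⊔ D ∈ T`, and `c₂` counts the `A ≤ D` with `I ⊔ A ∈ Y`.

* `classOf3` — the class of the index `i` as a finset of indices; `mem_classOf3`, `classOf3_eq_iff` (same class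
  iff connected);
* **`markClasses_eq_one_iff`**, **`markClasses_eq_three_iff`**, `markClasses_three_mem` (`N ∈ {1, 2, 3}`),
  **`markClasses_eq_two_iff`**.
-/

namespace PercRepro

open Finset

namespace MultiGraph

variable {V E : Type*} (G : MultiGraph V E) [DecidableEq V] [Fintype V] [Fintype E] [DecidableEq E]

/-- The class of the index `i` among the marks `m`, as a finset of indices. -/
def classOf3 (ω : Config E) {k : ℕ} (m : Fin k → V) (i : Fin k) : Finset (Fin k) :=
  univ.filter fun j => G.Conn ω (m i) (m j)

omit [DecidableEq E] in
/-- `markClasses` is the number of distinct classes. -/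
theorem markClasses_eq_card_image (ω : Config E) {k : ℕ} (m : Fin k → V) :
    G.markClasses ω m = (univ.image (G.classOf3 ω m)).card := rfl

omit [DecidableEq E] in
/-- Every index lies in its own class. -/
theorem mem_classOf3_self (ω : Config E) {k : ℕ} (m : Fin k → V) (i : Fin k) : i ∈ G.classOf3 ω m i := by
  simp [classOf3, MultiGraph.Conn.refl G]

omit [DecidableEq E] in
/-- Membership in a class. -/
theorem mem_classOf3 (ω : Config E) {k : ℕ} (m : Fin k → V) (i j : Fin k) :
    j ∈ G.classOf3 ω m i ↔ G.Conn ω (m i) (m j) := by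
  simp [classOf3]

omit [DecidableEq E] in
/-- Two indices have the same class iff they are connected. -/
theorem classOf3_eq_iff (ω : Config E) {k : ℕ} (m : Fin k → V) (i j : Fin k) :
    G.classOf3 ω m i = G.classOf3 ω m j ↔ G.Conn ω (m i) (m j) := by
  constructor
  · intro h
    have := G.mem_classOf3_self ω m j
    rw [← h, mem_classOf3] at this
    exact this
  · intro hij
    ext x
    rw [mem_classOf3, mem_classOf3]
    exact ⟨fun h => hij.symm.trans h, fun h => hij.trans h⟩

/-- The number of classes is the number of distinct values of `classOf3`, i.e. the size of a set of
representatives: it is `≤ k` and `≥ 1` when `k ≥ 1`. Here the three-mark cases. -/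
theorem markClasses_eq_one_iff (ω : Config E) (a b c : V) :
    G.markClasses ω ![a, b, c] = 1 ↔ ω ∈ G.allConn3 a b c := by
  rw [markClasses_eq_card_image, Finset.card_eq_one, allConn3, Finset.mem_filter]
  simp only [Finset.mem_univ, true_and]
  constructor
  · rintro ⟨s, hs⟩
    have h01 : G.classOf3 ω ![a, b, c] 0 = G.classOf3 ω ![a, b, c] 1 := by
      have h0 : G.classOf3 ω ![a, b, c] 0 ∈ univ.image (G.classOf3 ω ![a, b, c]) :=
        Finset.mem_image_of_mem _ (Finset.mem_univ _)
      have h1 : G.classOf3 ω ![a, b, c] 1 ∈ univ.image (G.classOf3 ω ![a, b, c]) :=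
        Finset.mem_image_of_mem _ (Finset.mem_univ _)
      rw [hs, Finset.mem_singleton] at h0 h1
      rw [h0, h1]
    have h12 : G.classOf3 ω ![a, b, c] 1 = G.classOf3 ω ![a, b, c] 2 := by
      have h1 : G.classOf3 ω ![a, b, c] 1 ∈ univ.image (G.classOf3 ω ![a, b, c]) :=
        Finset.mem_image_of_mem _ (Finset.mem_univ _)
      have h2 : G.classOf3 ω ![a, b, c] 2 ∈ univ.image (G.classOf3 ω ![a, b, c]) :=
        Finset.mem_image_of_mem _ (Finset.mem_univ _)
      rw [hs, Finset.mem_singleton] at h1 h2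
      rw [h1, h2]
    rw [classOf3_eq_iff] at h01 h12
    simp only [Matrix.cons_val_zero, Matrix.cons_val_one] at h01
    simp only [Matrix.cons_val_one, Matrix.head_cons, Matrix.cons_val_two, Matrix.tail_cons] at h12
    exact ⟨h01, h12, h01.trans h12⟩
  · rintro ⟨hab, hbc, hac⟩
    refine ⟨G.classOf3 ω ![a, b, c] 0, ?_⟩
    ext s
    rw [Finset.mem_image, Finset.mem_singleton]
    constructor
    · rintro ⟨i, -, rfl⟩
      fin_cases i
      · rfl
      · exact ((G.classOf3_eq_iff ω ![a, b, c] 1 0).mpr hab.symm)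
      · exact ((G.classOf3_eq_iff ω ![a, b, c] 2 0).mpr hac.symm)
    · rintro rfl
      exact ⟨0, Finset.mem_univ _, rfl⟩

/-- **`N(ω) = 3` iff the three marks are pairwise separated** (`B = allSep3`). -/
theorem markClasses_eq_three_iff (ω : Config E) (a b c : V) :
    G.markClasses ω ![a, b, c] = 3 ↔ ω ∈ G.allSep3 a b c := by
  rw [markClasses_eq_card_image, allSep3, Finset.mem_filter]
  simp only [Finset.mem_univ, true_and]
  constructor
  · intro h3
    have hinj : Set.InjOn (G.classOf3 ω ![a, b, c]) (Finset.univ : Finset (Fin 3)) :=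
      Finset.card_image_iff.mp (by rw [h3, Finset.card_univ, Fintype.card_fin])
    have hne : ∀ i j : Fin 3, i ≠ j → ¬ G.Conn ω (![a, b, c] i) (![a, b, c] j) := by
      intro i j hij h
      exact hij (hinj (Finset.mem_univ i) (Finset.mem_univ j)
        ((G.classOf3_eq_iff ω ![a, b, c] i j).mpr h))
    exact ⟨hne 0 1 (by decide), hne 1 2 (by decide), hne 0 2 (by decide)⟩
  · rintro ⟨hab, hbc, hac⟩
    have hinj : Set.InjOn (G.classOf3 ω ![a, b, c]) (Finset.univ : Finset (Fin 3)) := by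
      intro i _ j _ hij
      rw [G.classOf3_eq_iff] at hij
      by_contra hne
      fin_cases i <;> fin_cases j <;> simp at hne <;> simp at hij
      · exact hab hij
      · exact hac hij
      · exact hab hij.symm
      · exact hbc hij
      · exact hac hij.symm
      · exact hbc hij.symm
    rw [Finset.card_image_of_injOn hinj, Finset.card_univ, Fintype.card_fin]

omit [DecidableEq E] in
/-- The number of classes of three marks is `1`, `2` or `3`. -/
theorem markClasses_three_mem (ω : Config E) (a b c : V) :
    G.markClasses ω ![a, b, c] = 1 ∨ G.markClasses ω ![a, b, c] = 2 ∨ G.markClasses ω ![a, b, c] = 3 := by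
  have hle : G.markClasses ω ![a, b, c] ≤ 3 := by
    rw [markClasses_eq_card_image]
    exact (Finset.card_image_le).trans (by rw [Finset.card_univ, Fintype.card_fin])
  have hpos : 0 < G.markClasses ω ![a, b, c] := by
    rw [markClasses_eq_card_image, Finset.card_pos]
    exact ⟨_, Finset.mem_image_of_mem _ (Finset.mem_univ (0 : Fin 3))⟩
  omega

/-- **`N(ω) = 2` iff exactly one pair of the three marks is connected** (`Y = onePair3`). -/
theorem markClasses_eq_two_iff (ω : Config E) (a b c : V) :
    G.markClasses ω ![a, b, c] = 2 ↔ ω ∈ G.onePair3 a b c := by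
  have h1 := G.markClasses_eq_one_iff ω a b c
  have h3 := G.markClasses_eq_three_iff ω a b c
  have hmem := G.markClasses_three_mem ω a b c
  simp only [onePair3, allConn3, allSep3, Finset.mem_filter, Finset.mem_univ, true_and] at h1 h3 ⊢
  constructor
  · intro h2
    exact ⟨fun hT => by have := h1.mpr hT; omega, fun hB => by have := h3.mpr hB; omega⟩
  · rintro ⟨hT, hB⟩
    rcases hmem with h | h | h
    · exact absurd (h1.mp h) hT
    · exact h
    · exact absurd (h3.mp h) hB

end MultiGraph

end PercRepro
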